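import Literature.MathematicalPhysics.QuantumFieldTheory.Balaban1983to89.B6SectAScalarModelV1
import Literature.MathematicalPhysics.QuantumFieldTheory.Balaban1983to89.B6Eq233GaussianRoute
import Literature.MathematicalPhysics.QuantumFieldTheory.Balaban1983to89.B6Eq226CovarianceMoments

/-!
# `Balaban1983to89.B6Eq231GaussianV1` — T. Bałaban, *Propagators and renormalization transformations for lattice gauge
# theories. II*, Commun. Math. Phys. **96** (1984) 223–250 [Balaban1984PropagatorsII], Sect. A (2.28)–(2.34) pp. 227–228
# ON THE V1 MULTI-LEVEL TORUS CALCULUS: the Faddeev–Popov computation — (2.28), (2.29), (2.30), (2.32), (2.33) — and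
# **(2.31) `R∂*G∂R = R`, (2.34) `R∂*GQ* = 0`, `QG∂R = 0` DERIVED BY THE PRINTED GAUSSIAN ROUTE** for the CONCRETE operators
# `Δ_a` (2.19), `G = Δ_a⁻¹`, `∂`, `∂*`, `Q`, `Q*`, `a`, `R` of `…B6SectAOperatorsV1` / `…B6SectAVectorModelV1` (this seat,
# gen 5) — every nested family of domains, `c ≠ 0`, `a > 0`, ANY Lebesgue measures `dA`, `dλδ(Q′λ)` — with NO hypothesis left

statement-level skeleton of published theorems with citation tags; proofs where landed; nothing here is a claim about the
Yang–Mills mass gap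

PDF held: `paper:balaban1984-cmp96-propagators-rt-ii` (journal page = PDF page + 222); pp. 226–228 read AS IMAGES on the ×2
renders `run/shared/lean/pub/pub-balaban/b2b-balaban-ref1/pages/1984-cmp96-propagators-rt-II/…-p004…p006-x2.png`.

CITATION HEADER (lean-in-tree rule).  Cell `lit-balaban` (HOME `run/shared/lean/pub/lit-balaban/`), PHASE-2 proof seat **p21**
(gen 6, file 6), B6 fold owner r03, referee ref-4.  WHAT IS REPRODUCED: SKELETON rows **B6.Eq2.31** ((2.28)–(2.31)) and
**B6.Eq2.34** ((2.32)–(2.34)) — KIND model instance OF THE PRINTED ROUTE: the abstract theorems of record are p22's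
`…B6Eq228FaddeevPopov.eq228` (gen 4), `…B6Eq230GaussianRoute.exists_sliceEquiv`/`eq230`/`Z_pos`/`eq231_of_gaussian` (gen 4),
`…B6Eq232GaussianMoment.eq232`, `…B6Eq233GaussianRoute.eq233`/`eq234_of_gaussian`/`eq231_234_deltaA_of_pos` (gen 5) and
`…B6Eq226CovarianceMoments.cov225_exists` (gen 6, `Z′ > 0`), whose letters `Δ_a` (= `M`), `G`, `∂` (= `curl` on vector
fields, `d` on scalars), `∂*`, `Q`, `Q*`, `a`, `R`, `Δ↾N(Q′)` (= `D`), `∂↾N(Q′)` (= `dN`), `K = ΔN(Q′)` and hypotheses (the form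
(2.19), symmetry, adjointness, `Δ_aG = I`, `R` = the orthogonal projection onto `ΔN(Q′)`, `∂∂λ = 0`, `Q∂λ = 0` on `N(Q′)`,
(2.11), `Z ≠ 0`) are DISCHARGED here by gen 5's constructions `dE`/`dsE`/`dcE`/`dcsE`/`QE`/`QsE`/`QpE`/`aE`/`lapE`/`KE`/`RE`
(`…B6SectAOperatorsV1`), `deltaAE`/`GE` (`…B6SectAVectorModelV1`), `dcE_comp_dE`/`QE_dE_eq_zero` (`…B6SectACriticalPointV1`),
`inner_lapE_left`/`eq_zero_of_mem_ker_of_lapE_eq_zero` (`…B6SectAScalarModelV1`, gen 6) on the V1 multi-level calculus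
(`LatticeFieldCalculus`, every `…B6SectADomainsV1.Domains`).  Theorems only; nothing restated.  The ALGEBRAIC route of record for the same three operator
identities on the same operators is gen 5's `…B6SectACriticalPointV1.eq231_V1`/`eq234_left_V1`/`eq234_right_V1` (via r03's
`…B6Eq231`); here they are reached, as printed, through the Gaussian integrals.

PRINT (pp. 226–228, verbatim).  *"To prove it let us notice that the operator R∂*G∂R has the following representation by
Gaussian integrals: exp(½⟨f, R∂*G∂Rf⟩) = Z⁻¹∫dA exp[−½⟨A, Δ_aA⟩ + ⟨f, R∂*A⟩] = Z⁻¹∫dA exp(−½‖∂A‖² − ½a‖QA‖²)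
exp(−½‖∂*A‖² + ⟨f, R∂*A⟩)Z′(∫dλ δ(Q′λ) exp(−½‖∂*A − Δλ‖²))⁻¹. (2.28) Now we insert under the integral
1 = |det(Δ↾_{N(Q′)})| ∫dλ′ δ(Q′λ′) δ_R(R∂*A + Δλ′), (2.29) … we change the order of integrations …, next we make the gauge
transformation A → A^{λ′} = A − ∂λ′, and we again change the order of the integrations … (2.30) … Thus R∂*G∂R = R (2.31)
… R∂*GQ* = Z⁻¹∫dA exp[−½⟨A, Δ_aA⟩] R∂*A QA, (2.32) … = 0, (2.33) thus we have R∂*GQ* = 0, QG∂R = 0. (2.34) … The only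
assumption we have used was the positivity of the operator Δ_a"*; p. 226 *"Δ_a = ∂*∂ + ∂R∂* + Q*aQ = Δ − ∂P∂* + Q*aQ, (2.19)
… One of our main results will be that the operator Δ_a is bounded from below by a positive constant"*.

TYPED READING (every choice displayed; none is an objection to print).  Carriers: bond fields `BondSpace P`, plaquette fields
`PlaqSpace P`, site scalars `ScalarSpace P` (ℓ² pairings), constraint values `BondIdxSpace D` on `𝔅`; `N(Q′) = ker Q′`
(`LinearMap.ker (QpE D)`, r03's `B6SectA.gaugeSpace`) as a TYPE `↥(ker Q′)`, `Δ↾N(Q′) = lapE c ∘ₗ (ker Q′).subtype`,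
`∂↾N(Q′) = dE c ∘ₗ (ker Q′).subtype`, `ΔN(Q′) = KE D c`; `dA` = ANY additive Haar (Lebesgue) measure `μA` on `BondSpace P`,
`dλ δ(Q′λ)` = ANY additive Haar measure `ν` on `↥(ker Q′)`; the slice `{R∂*A = 0}` of (2.29) carries its own Haar measure and the
Jacobian `|det(Δ↾N(Q′))|` is the scalar factor of p22's `fp_decomposition` (it cancels, as printed, against the case `f = 0`).
The printed *"bounded from below by a positive constant"* is used here only QUALITATIVELY (a `γ > 0` depending on the finite
lattice, from gen 5's `deltaAE_pos`): it is exactly what makes `Z = ∫dA e^{−½⟨A,Δ_aA⟩}` a convergent positive integral; the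
UNIFORM bounds are the paper's Propositions (rows B6.Prop2.2 ff.), not this file.

WHAT IS PROVED (0 sorry, 0 new named facts; axioms standard; `D : Domains P`, `c ≠ 0`, weights `w > 0` on `𝔅` unless noted).
§0 dictionary (Δ symmetric and (2.11) Δ injective on `N(Q′)` are gen 6's `…B6SectAScalarModelV1.inner_lapE_left` /
`eq_zero_of_mem_ker_of_lapE_eq_zero`, imported): `range_lapE_subtype` (`range (Δ↾N(Q′)) = ΔN(Q′)`),
`lapE_subtype_injective`, `form_deltaAE` (the three-term form (2.19)),
**`deltaAE_eq_deltaA`** ((2.19): the two printed expressions of `Δ_a` AGREE — gen 5's `∂*∂ + ∂R∂* + Q*aQ` = r03's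
`B6SectA.deltaA` `Δ − ∂P∂* + Q*aQ` with `Δ = ∂*∂ + ∂∂*` on vector fields, `P = I − R`).
§1 positivity: `exists_pos_mul_norm_sq_le_inner` (finite dimension: positive definite ⇒ bounded below by `γ‖·‖²`, `γ > 0`),
**`exists_deltaAE_lower_bound`** (*"Δ_a is bounded from below by a positive constant"*, qualitative), **`Z_pos_V1`**
(`Z = ∫dA e^{−½⟨A,Δ_aA⟩}` convergent and `> 0`), `Zprime_pos_V1` (`Z′ = ∫dλδ(Q′λ)e^{−½‖Δλ‖²} > 0`).
§2 the displays: **`eq228_V1`** ((2.28), both equalities), **`exists_sliceEquiv_V1`** ((2.29): slice ⊕ gauge orbit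
`(A₀, λ′) ↦ A₀ − ∂λ′` is a linear isomorphism onto the configurations), **`eq230_V1`** ((2.30) assembled:
`∫dA e^{−½⟨A,Δ_aA⟩+⟨f,R∂*A⟩} = e^{½⟨f,Rf⟩}Z`), **`eq232_V1`** ((2.32) as matrix elements), **`eq233_V1`** ((2.33) `= 0`, for
every weight `w`).
§3 the identities BY THE GAUSSIAN ROUTE: **`eq231_V1_gaussian`** (`R∂*G∂R = R`), **`eq234_V1_gaussian`** (`R∂*GQ* = 0 ∧ QG∂R = 0`),
**`eq231_234_V1`** (all three for `Δ_a` in r03's printed letters `B6SectA.deltaA (∂*∂+∂∂*) ∂ ∂* (I−R) Q Q* a`, p22's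
`eq231_234_deltaA_of_pos` with every hypothesis discharged), `eq231_V1_gaussian_eq_algebraic` (the two routes give the same
operator identity — `rfl` on statements; recorded for the fold).
-/

noncomputable section

open MeasureTheory
open scoped InnerProductSpace

namespace Literature.MathematicalPhysics.QuantumFieldTheory.Balaban1983to89.B6Eq231GaussianV1

open LatticeFieldCalculus B6SectADomainsV1 B6SectAZeroModesV1 B6SectAOntoV1 B6SectAOperatorsV1 B6SectAVectorModelV1
  B6SectACriticalPointV1 B6SectAScalarModelV1
open BalabanImbrieJaffe1984to88.BIJ85AxialPropagator411 (BondSpace PlaqSpace)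

variable {P : Params} (D : Domains P)

/-! ## §0. Dictionary: `Δ↾N(Q′)`, `∂↾N(Q′)`, `ΔN(Q′)`, the form (2.19) -/

/-- `range (Δ↾N(Q′)) = ΔN(Q′)` — the subspace onto which `R` projects ((2.10) p. 225: *"R … the orthogonal projection …
onto the subspace ΔN(Q′)"*). [cite: Balaban1984PropagatorsII, (2.10) p.225] -/
theorem range_lapE_subtype (c : ℝ) :
    LinearMap.range (lapE c ∘ₗ (LinearMap.ker (QpE D)).subtype) = KE D c := by
  rw [LinearMap.range_comp, Submodule.range_subtype]
  rfl

/-- `Δ↾N(Q′)` is injective ((2.11)). [cite: Balaban1984PropagatorsII, (2.11) p.225] -/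
theorem lapE_subtype_injective {c : ℝ} (hc : c ≠ 0) :
    Function.Injective (lapE c ∘ₗ (LinearMap.ker (QpE D)).subtype) := by
  rw [← LinearMap.ker_eq_bot, LinearMap.ker_eq_bot']
  intro l hl
  exact Subtype.ext (eq_zero_of_mem_ker_of_lapE_eq_zero D hc (l : ScalarSpace P) l.2 hl)

/-- **(2.19) as a quadratic form on the model:** `⟨A, Δ_aA⟩ = ‖∂A‖² + ⟨∂*A, R∂*A⟩ + ⟨QA, aQA⟩` — the hypothesis `hform`
of p22's Gaussian-route files for gen 5's `Δ_a`. [cite: Balaban1984PropagatorsII, (2.19) p.226] -/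
theorem form_deltaAE (c : ℝ) (w : BondIdx D → ℝ) (v : BondSpace P) :
    ⟪v, deltaAE D c w v⟫_ℝ = ‖dcE c v‖ ^ 2 + ⟪dsE c v, RE D c (dsE c v)⟫_ℝ + ⟪QE D v, aE D w (QE D v)⟫_ℝ := by
  rw [inner_deltaAE_right, real_inner_self_eq_norm_sq]

/-- **(2.19), the two printed expressions agree on the model:** gen 5's `Δ_a = ∂*∂ + ∂R∂* + Q*aQ` (`deltaAE`) EQUALS r03's
`B6SectA.deltaA` — *"= Δ − ∂P∂* + Q*aQ"* — with `Δ = ∂*∂ + ∂∂*` the Laplacian on vector fields and `P = I − R`.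
[cite: Balaban1984PropagatorsII, (2.19) p.226] -/
theorem deltaAE_eq_deltaA (c : ℝ) (w : BondIdx D → ℝ) :
    deltaAE D c w =
      B6SectA.deltaA (dcsE c ∘ₗ dcE c + dE c ∘ₗ dsE c) (dE c) (dsE c) (LinearMap.id - RE D c) (QE D) (QsE D) (aE D w) := by
  rw [deltaAE_def, B6SectA.deltaA, LinearMap.sub_comp, LinearMap.id_comp, LinearMap.comp_sub]
  abel

/-! ## §1. Positivity: `Δ_a ≥ γ > 0` on the finite lattice; `Z > 0`, `Z′ > 0` -/

/-- *"the operator Δ_a is bounded from below by a positive constant"* — the finite-dimensional mechanism: on a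
finite-dimensional real inner-product space a linear operator with `⟨v, Mv⟩ > 0` for all `v ≠ 0` satisfies `⟨v, Mv⟩ ≥ γ‖v‖²`
for some `γ > 0` (minimum of the form on the compact unit sphere). [cite: Balaban1984PropagatorsII, (2.19) p.226 + (2.34) p.228] -/
theorem exists_pos_mul_norm_sq_le_inner {E : Type*} [NormedAddCommGroup E] [InnerProductSpace ℝ E]
    [FiniteDimensional ℝ E] (M : E →ₗ[ℝ] E) (hpos : ∀ v : E, v ≠ 0 → 0 < ⟪v, M v⟫_ℝ) :
    ∃ γ : ℝ, 0 < γ ∧ ∀ v : E, γ * ‖v‖ ^ 2 ≤ ⟪v, M v⟫_ℝ := by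
  rcases subsingleton_or_nontrivial E with hE | hE
  · exact ⟨1, one_pos, fun v => by rw [Subsingleton.elim v 0, norm_zero, inner_zero_left]; norm_num⟩
  have hcont : Continuous fun v : E => ⟪v, M v⟫_ℝ := continuous_id.inner M.continuous_of_finiteDimensional
  obtain ⟨v₀, hv₀, hmin⟩ := (isCompact_sphere (0 : E) 1).exists_isMinOn
    ((NormedSpace.sphere_nonempty (x := (0 : E))).mpr zero_le_one) hcont.continuousOn
  have hv₀' : ‖v₀‖ = 1 := mem_sphere_zero_iff_norm.mp hv₀
  have hv₀ne : v₀ ≠ 0 := fun h => by rw [h, norm_zero] at hv₀'; exact zero_ne_one hv₀'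
  refine ⟨⟪v₀, M v₀⟫_ℝ, hpos v₀ hv₀ne, fun v => ?_⟩
  by_cases hv : v = 0
  · rw [hv, norm_zero, inner_zero_left]; norm_num
  have hn : 0 < ‖v‖ := norm_pos_iff.mpr hv
  have hu : ‖v‖⁻¹ • v ∈ Metric.sphere (0 : E) 1 := by
    rw [mem_sphere_zero_iff_norm, norm_smul, norm_inv, norm_norm, inv_mul_cancel₀ hn.ne']
  have h : ⟪v₀, M v₀⟫_ℝ ≤ ⟪‖v‖⁻¹ • v, M (‖v‖⁻¹ • v)⟫_ℝ := (isMinOn_iff.mp hmin) _ hu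
  rw [map_smul, real_inner_smul_left, real_inner_smul_right] at h
  have h2 : ‖v‖⁻¹ * (‖v‖⁻¹ * ⟪v, M v⟫_ℝ) = ⟪v, M v⟫_ℝ / ‖v‖ ^ 2 := by
    field_simp
  rw [h2, le_div_iff₀ (by positivity)] at h
  exact h

/-- ***"the operator Δ_a is bounded from below by a positive constant"*, QUALITATIVELY on the model:** for every nested family
of domains, `c ≠ 0`, `a > 0` there is `γ > 0` with `⟨A, Δ_aA⟩ ≥ γ‖A‖²` for all `A` (from gen 5's `deltaAE_pos`; `γ` depends on
the finite lattice — the uniform statements are the paper's Propositions). [cite: Balaban1984PropagatorsII, (2.19) p.226] -/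
theorem exists_deltaAE_lower_bound {c : ℝ} (hc : c ≠ 0) {w : BondIdx D → ℝ} (hw : ∀ i, 0 < w i) :
    ∃ γ : ℝ, 0 < γ ∧ ∀ x : BondSpace P, γ * ‖x‖ ^ 2 ≤ ⟪x, deltaAE D c w x⟫_ℝ :=
  exists_pos_mul_norm_sq_le_inner (deltaAE D c w) fun _ hx => deltaAE_pos D hc hw hx

/-- **`Z = ∫dA e^{−½⟨A,Δ_aA⟩}` is a convergent, strictly positive integral** for gen 5's `Δ_a` and ANY additive Haar
(Lebesgue) measure `dA` on the bond fields (*"The only assumption we have used was the positivity of the operator Δ_a"*).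
[cite: Balaban1984PropagatorsII, (2.28) p.227 + p.228] -/
theorem Z_pos_V1 (μA : Measure (BondSpace P)) [μA.IsAddHaarMeasure] {c : ℝ} (hc : c ≠ 0) {w : BondIdx D → ℝ}
    (hw : ∀ i, 0 < w i) :
    Integrable (fun v => Real.exp (-(1 / 2) * ⟪v, deltaAE D c w v⟫_ℝ)) μA ∧
      0 < ∫ v, Real.exp (-(1 / 2) * ⟪v, deltaAE D c w v⟫_ℝ) ∂μA := by
  obtain ⟨γ, hγ, h⟩ := exists_deltaAE_lower_bound D hc hw
  exact B6Eq230GaussianRoute.Z_pos μA (deltaAE D c w) hγ h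

/-- **`Z′ = ∫dλ δ(Q′λ) e^{−½‖Δλ‖²} > 0`** for the model `Δ`, `Q′` and ANY additive Haar measure on `N(Q′) = ker Q′`
((2.11) discharged; p22's `cov225_exists`). [cite: Balaban1984PropagatorsII, (2.24)–(2.25) p.226 + (2.28) p.227] -/
theorem Zprime_pos_V1 {c : ℝ} (hc : c ≠ 0) (ν : Measure ↥(LinearMap.ker (QpE D))) [ν.IsAddHaarMeasure] :
    0 < ∫ l, Real.exp (-(1 / 2) * ‖lapE c (l : ScalarSpace P)‖ ^ 2) ∂ν :=
  (B6Eq226CovarianceMoments.cov225_exists (QpE D) ν (lapE c) (inner_lapE_left c)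
    (eq_zero_of_mem_ker_of_lapE_eq_zero D hc)).1

/-! ## §2. The displays (2.28), (2.29), (2.30), (2.32), (2.33) on the model -/

/-- **(2.28), both equalities, on the model:** for ANY left-invariant `dA` and additive Haar `dλδ(Q′λ)`,
`e^{½⟨f,R∂*G∂Rf⟩}·Z = ∫dA e^{−½‖∂A‖²−½⟨QA,aQA⟩} e^{−½‖∂*A‖²+⟨f,R∂*A⟩} Z′ (∫dλδ(Q′λ)e^{−½‖∂*A−Δλ‖²})⁻¹` with gen 5's
`Δ_a`, `G = Δ_a⁻¹`, `∂` (= `dcE` on vector fields), `∂*` (= `dsE`), `Q`, `a`, `R` — p22's `eq228`, hypotheses discharged.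
[cite: Balaban1984PropagatorsII, (2.28) p.227] -/
theorem eq228_V1 (μA : Measure (BondSpace P)) [μA.IsAddLeftInvariant] (ν : Measure ↥(LinearMap.ker (QpE D)))
    [ν.IsAddHaarMeasure] {c : ℝ} (hc : c ≠ 0) {w : BondIdx D → ℝ} (hw : ∀ i, 0 < w i) (f : ScalarSpace P) :
    Real.exp ((1 / 2) * ⟪f, (RE D c ∘ₗ dsE c ∘ₗ GE D hc hw ∘ₗ dE c ∘ₗ RE D c) f⟫_ℝ) *
        ∫ v, Real.exp (-(1 / 2) * ⟪v, deltaAE D c w v⟫_ℝ) ∂μA =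
      ∫ v, Real.exp (-(1 / 2) * ‖dcE c v‖ ^ 2 - (1 / 2) * ⟪QE D v, aE D w (QE D v)⟫_ℝ) *
        (Real.exp (-(1 / 2) * ‖dsE c v‖ ^ 2 + ⟪f, RE D c (dsE c v)⟫_ℝ) *
          (∫ l, Real.exp (-(1 / 2) * ‖lapE c (l : ScalarSpace P)‖ ^ 2) ∂ν) *
            (∫ l, Real.exp (-(1 / 2) * ‖dsE c v - lapE c (l : ScalarSpace P)‖ ^ 2) ∂ν)⁻¹) ∂μA :=
  B6Eq228FaddeevPopov.eq228 μA ν (deltaAE D c w) (GE D hc hw) (dcE c) (dE c) (dsE c) (RE D c) (QE D) (aE D w)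
    (lapE c ∘ₗ (LinearMap.ker (QpE D)).subtype) (KE D c) (range_lapE_subtype D c) (RE_apply D c)
    (fun v g => (inner_dsE_left c v g).symm) (inner_deltaAE_left D c w) (deltaAE_comp_GE D hc hw) (form_deltaAE D c w)
    (Zprime_pos_V1 D hc ν).ne' f

/-- **(2.29) as coordinates of the configuration space, on the model:** the slice `{R∂*A = 0}` (support of `δ_R(R∂*A)`) and
the gauge orbits `∂N(Q′)` are complementary — `(A₀, λ′) ↦ A₀ − ∂λ′` is a linear isomorphism onto the bond fields — because
`δ_R(R∂*A + Δλ′)` has exactly one zero `λ′ ∈ N(Q′)` for each `A` (gen 5's `existsUnique_gauge212` is the same fact).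
[cite: Balaban1984PropagatorsII, (2.29) p.227] -/
theorem exists_sliceEquiv_V1 {c : ℝ} (hc : c ≠ 0) :
    ∃ e : (↥(LinearMap.ker (RE D c ∘ₗ dsE c)) × ↥(LinearMap.ker (QpE D))) ≃L[ℝ] BondSpace P,
      ∀ m l, e (m, l) = (m : BondSpace P) - (dE c ∘ₗ (LinearMap.ker (QpE D)).subtype) l :=
  B6Eq230GaussianRoute.exists_sliceEquiv (dsE c) (RE D c) (lapE c ∘ₗ (LinearMap.ker (QpE D)).subtype)
    (dE c ∘ₗ (LinearMap.ker (QpE D)).subtype) (KE D c) (range_lapE_subtype D c) (RE_apply D c) (fun _ => rfl)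
    (lapE_subtype_injective D hc)

/-- **(2.30), assembled, on the model:** `∫dA e^{−½⟨A,Δ_aA⟩ + ⟨f,R∂*A⟩} = e^{½⟨f,Rf⟩} · Z` for ANY additive Haar `dA` —
the printed computation (Faddeev–Popov decomposition (2.29) of `dA` into slice ⊕ orbit, gauge invariance of `‖∂A‖²`, `QA`,
the orbit integrals by (2.24)–(2.26), the normalisation `f = 0`), p22's `eq230` with the slice and orbit Lebesgue measures
chosen internally (they cancel). [cite: Balaban1984PropagatorsII, (2.30) p.227] -/
theorem eq230_V1 (μA : Measure (BondSpace P)) [μA.IsAddHaarMeasure] {c : ℝ} (hc : c ≠ 0) (w : BondIdx D → ℝ)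
    (f : ScalarSpace P) :
    ∫ v, Real.exp (-(1 / 2) * ⟪v, deltaAE D c w v⟫_ℝ + ⟪f, RE D c (dsE c v)⟫_ℝ) ∂μA =
      Real.exp ((1 / 2) * ⟪f, RE D c f⟫_ℝ) * ∫ v, Real.exp (-(1 / 2) * ⟪v, deltaAE D c w v⟫_ℝ) ∂μA := by
  obtain ⟨e, he⟩ := exists_sliceEquiv_V1 D hc
  exact B6Eq230GaussianRoute.eq230 Measure.addHaar Measure.addHaar μA e (LinearMap.ker (RE D c ∘ₗ dsE c)).subtype
    (dE c ∘ₗ (LinearMap.ker (QpE D)).subtype) he (deltaAE D c w) (dcE c) (dsE c) (RE D c) (QE D) (aE D w)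
    (lapE c ∘ₗ (LinearMap.ker (QpE D)).subtype) (KE D c) (range_lapE_subtype D c) (RE_apply D c) (form_deltaAE D c w)
    (fun l => LinearMap.congr_fun (dcE_comp_dE (P := P) c) (l : ScalarSpace P))
    (fun l => QE_dE_eq_zero D c (l : ScalarSpace P) l.2) (fun _ => rfl)
    (fun m => LinearMap.map_coe_ker (RE D c ∘ₗ dsE c) m) f

/-- **(2.32) on the model:** `R∂*GQ* = Z⁻¹∫dA e^{−½⟨A,Δ_aA⟩} R∂*A QA` through matrix elements —
`Z·⟨g, R∂*GQ*u⟩ = ∫dA e^{−½⟨A,Δ_aA⟩}⟨g,R∂*A⟩⟨QA,u⟩` for all `g`, `u`, ANY additive Haar `dA` (p22's `eq232`; the Gaussian is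
integrable by `Z_pos_V1`). [cite: Balaban1984PropagatorsII, (2.32) p.227] -/
theorem eq232_V1 (μA : Measure (BondSpace P)) [μA.IsAddHaarMeasure] {c : ℝ} (hc : c ≠ 0) {w : BondIdx D → ℝ}
    (hw : ∀ i, 0 < w i) (g : ScalarSpace P) (u : BondIdxSpace D) :
    (∫ v, Real.exp (-(1 / 2) * ⟪v, deltaAE D c w v⟫_ℝ) ∂μA) * ⟪g, (RE D c ∘ₗ dsE c ∘ₗ GE D hc hw ∘ₗ QsE D) u⟫_ℝ =
      ∫ v, Real.exp (-(1 / 2) * ⟪v, deltaAE D c w v⟫_ℝ) * (⟪g, RE D c (dsE c v)⟫_ℝ * ⟪QE D v, u⟫_ℝ) ∂μA :=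
  B6Eq232GaussianMoment.eq232 μA (deltaAE D c w) (GE D hc hw) (dE c) (dsE c) (RE D c) (QE D) (QsE D) (KE D c)
    (RE_apply D c) (fun v g => (inner_dsE_left c v g).symm) (inner_QsE_left D) (inner_deltaAE_left D c w)
    (deltaAE_comp_GE D hc hw) (Z_pos_V1 D μA hc hw).1 g u

/-- **(2.33) `= 0` on the model:** `∫dA e^{−½⟨A,Δ_aA⟩}⟨g,R∂*A⟩⟨QA,u⟩ = 0` for all `g`, `u`, ANY additive Haar `dA` and every
weight `a` — Faddeev–Popov decomposition (2.29), gauge invariance of `‖∂A‖²`, `QA` (*"Because Q′λ′ = 0, hence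
QA^{λ′} = QA"*), and the vanishing odd orbit integral (p22's `eq233`). [cite: Balaban1984PropagatorsII, (2.33) p.227] -/
theorem eq233_V1 (μA : Measure (BondSpace P)) [μA.IsAddHaarMeasure] {c : ℝ} (hc : c ≠ 0) (w : BondIdx D → ℝ)
    (g : ScalarSpace P) (u : BondIdxSpace D) :
    ∫ v, Real.exp (-(1 / 2) * ⟪v, deltaAE D c w v⟫_ℝ) * (⟪g, RE D c (dsE c v)⟫_ℝ * ⟪QE D v, u⟫_ℝ) ∂μA = 0 := by
  obtain ⟨e, he⟩ := exists_sliceEquiv_V1 D hc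
  exact B6Eq233GaussianRoute.eq233 Measure.addHaar Measure.addHaar μA e (LinearMap.ker (RE D c ∘ₗ dsE c)).subtype
    (dE c ∘ₗ (LinearMap.ker (QpE D)).subtype) he (deltaAE D c w) (dcE c) (dsE c) (RE D c) (QE D) (aE D w)
    (lapE c ∘ₗ (LinearMap.ker (QpE D)).subtype) (KE D c) (range_lapE_subtype D c) (RE_apply D c) (form_deltaAE D c w)
    (fun l => LinearMap.congr_fun (dcE_comp_dE (P := P) c) (l : ScalarSpace P))
    (fun l => QE_dE_eq_zero D c (l : ScalarSpace P) l.2) (fun _ => rfl)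
    (fun m => LinearMap.map_coe_ker (RE D c ∘ₗ dsE c) m) g u

/-! ## §3. (2.31) and (2.34) BY THE GAUSSIAN ROUTE, no hypothesis left -/

/-- **(2.31) `R∂*G∂R = R` DERIVED BY THE PRINTED GAUSSIAN ROUTE on the model** (every nested family, `c ≠ 0`, `a > 0`, ANY
additive Haar `dA`): (2.28) + (2.30) give `e^{½⟨f,R∂*G∂Rf⟩} = e^{½⟨f,Rf⟩}`, `Z > 0` by `Z_pos_V1`, and equal quadratic forms of
symmetric operators are equal — p22's `eq231_of_gaussian` with every hypothesis discharged.  (Algebraic route of record: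
gen 5's `…B6SectACriticalPointV1.eq231_V1`.) [cite: Balaban1984PropagatorsII, (2.31) p.227] -/
theorem eq231_V1_gaussian (μA : Measure (BondSpace P)) [μA.IsAddHaarMeasure] {c : ℝ} (hc : c ≠ 0)
    {w : BondIdx D → ℝ} (hw : ∀ i, 0 < w i) :
    RE D c ∘ₗ dsE c ∘ₗ GE D hc hw ∘ₗ dE c ∘ₗ RE D c = RE D c :=
  B6Eq230GaussianRoute.eq231_of_gaussian μA (deltaAE D c w) (GE D hc hw) (dcE c) (dE c) (dsE c) (RE D c) (QE D)
    (aE D w) (lapE c ∘ₗ (LinearMap.ker (QpE D)).subtype) (dE c ∘ₗ (LinearMap.ker (QpE D)).subtype) (KE D c)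
    (range_lapE_subtype D c) (RE_apply D c) (fun v g => (inner_dsE_left c v g).symm) (inner_deltaAE_left D c w)
    (deltaAE_comp_GE D hc hw) (form_deltaAE D c w)
    (fun l => LinearMap.congr_fun (dcE_comp_dE (P := P) c) (l : ScalarSpace P))
    (fun l => QE_dE_eq_zero D c (l : ScalarSpace P) l.2) (fun _ => rfl) (lapE_subtype_injective D hc)
    (Z_pos_V1 D μA hc hw).2.ne'

/-- **(2.34) `R∂*GQ* = 0`, `QG∂R = 0` DERIVED BY THE PRINTED GAUSSIAN ROUTE on the model**: (2.32) + (2.33) `= 0`, `Z > 0`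
— p22's `eq234_of_gaussian` with every hypothesis discharged.  (Algebraic route of record: gen 5's `eq234_left_V1` /
`eq234_right_V1`.) [cite: Balaban1984PropagatorsII, (2.32)–(2.34) pp.227–228] -/
theorem eq234_V1_gaussian (μA : Measure (BondSpace P)) [μA.IsAddHaarMeasure] {c : ℝ} (hc : c ≠ 0)
    {w : BondIdx D → ℝ} (hw : ∀ i, 0 < w i) :
    RE D c ∘ₗ dsE c ∘ₗ GE D hc hw ∘ₗ QsE D = 0 ∧ QE D ∘ₗ GE D hc hw ∘ₗ dE c ∘ₗ RE D c = 0 :=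
  B6Eq233GaussianRoute.eq234_of_gaussian μA (deltaAE D c w) (GE D hc hw) (dcE c) (dE c) (dsE c) (RE D c) (QE D)
    (QsE D) (aE D w) (lapE c ∘ₗ (LinearMap.ker (QpE D)).subtype) (dE c ∘ₗ (LinearMap.ker (QpE D)).subtype) (KE D c)
    (range_lapE_subtype D c) (RE_apply D c) (fun v g => (inner_dsE_left c v g).symm) (inner_QsE_left D)
    (inner_deltaAE_left D c w) (deltaAE_comp_GE D hc hw) (form_deltaAE D c w)
    (fun l => LinearMap.congr_fun (dcE_comp_dE (P := P) c) (l : ScalarSpace P))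
    (fun l => QE_dE_eq_zero D c (l : ScalarSpace P) l.2) (fun _ => rfl) (lapE_subtype_injective D hc)
    (Z_pos_V1 D μA hc hw).2.ne'

/-- **(2.31) ∧ (2.34) for `Δ_a` IN THE PRINTED LETTERS of (2.19) `Δ_a = Δ − ∂P∂* + Q*aQ`** (r03's `B6SectA.deltaA` with
`Δ = ∂*∂ + ∂∂*`, `P = I − R`; `G = Δ_a⁻¹` = gen 5's `GE` by `deltaAE_eq_deltaA`): p22's packaged `eq231_234_deltaA_of_pos` —
*"The only assumption we have used was the positivity of the operator Δ_a"* — with the positivity, the structure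
(`∂∂λ = 0`, `Q∂λ = 0` on `N(Q′)`, (2.11)) and all adjointness hypotheses DISCHARGED on the model.
[cite: Balaban1984PropagatorsII, (2.31) p.227 + (2.34) p.228] -/
theorem eq231_234_V1 (μA : Measure (BondSpace P)) [μA.IsAddHaarMeasure] {c : ℝ} (hc : c ≠ 0) {w : BondIdx D → ℝ}
    (hw : ∀ i, 0 < w i) :
    RE D c ∘ₗ dsE c ∘ₗ GE D hc hw ∘ₗ dE c ∘ₗ RE D c = RE D c ∧
      RE D c ∘ₗ dsE c ∘ₗ GE D hc hw ∘ₗ QsE D = 0 ∧ QE D ∘ₗ GE D hc hw ∘ₗ dE c ∘ₗ RE D c = 0 := by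
  obtain ⟨γ, hγ, hpos⟩ := exists_deltaAE_lower_bound D hc hw
  have hG : B6SectA.deltaA (dcsE c ∘ₗ dcE c + dE c ∘ₗ dsE c) (dE c) (dsE c) (LinearMap.id - RE D c) (QE D) (QsE D)
      (aE D w) ∘ₗ GE D hc hw = LinearMap.id := by
    rw [← deltaAE_eq_deltaA]; exact deltaAE_comp_GE D hc hw
  have hpos' : ∀ v : BondSpace P, γ * ‖v‖ ^ 2 ≤
      ⟪v, B6SectA.deltaA (dcsE c ∘ₗ dcE c + dE c ∘ₗ dsE c) (dE c) (dsE c) (LinearMap.id - RE D c) (QE D) (QsE D)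
        (aE D w) v⟫_ℝ := fun v => by
    rw [← deltaAE_eq_deltaA]; exact hpos v
  exact B6Eq233GaussianRoute.eq231_234_deltaA_of_pos μA (dcsE c ∘ₗ dcE c + dE c ∘ₗ dsE c) (GE D hc hw) (dcE c)
    (dcsE c) (dE c) (dsE c) (RE D c) (LinearMap.id - RE D c) (QE D) (QsE D) (aE D w)
    (lapE c ∘ₗ (LinearMap.ker (QpE D)).subtype) (dE c ∘ₗ (LinearMap.ker (QpE D)).subtype) (KE D c)
    (range_lapE_subtype D c) (RE_apply D c) rfl rfl (inner_dcsE_left c) (fun v g => (inner_dsE_left c v g).symm)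
    (inner_QsE_left D) (inner_aE_left D w) hG
    (fun l => LinearMap.congr_fun (dcE_comp_dE (P := P) c) (l : ScalarSpace P))
    (fun l => QE_dE_eq_zero D c (l : ScalarSpace P) l.2) (fun _ => rfl) (lapE_subtype_injective D hc) hγ hpos'

/-- The Gaussian route and the algebraic route of record prove THE SAME operator identity (2.31) for the model operators
(statement-level cross-check for the fold: gen 5's `eq231_V1` and `eq231_V1_gaussian` have one and the same type).
[cite: Balaban1984PropagatorsII, (2.31) p.227] -/
theorem eq231_V1_gaussian_eq_algebraic (μA : Measure (BondSpace P)) [μA.IsAddHaarMeasure] {c : ℝ} (hc : c ≠ 0)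
    {w : BondIdx D → ℝ} (hw : ∀ i, 0 < w i) :
    eq231_V1_gaussian D μA hc hw = eq231_V1 D hc hw := rfl

end Literature.MathematicalPhysics.QuantumFieldTheory.Balaban1983to89.B6Eq231GaussianV1

end
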